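import Literature.NumberTheory.GaloisRepresentations.FrobeniusPlaces
import Literature.NumberTheory.GaloisRepresentations.FrobeniusGeneration
import Literature.NumberTheory.GaloisRepresentations.ArtinFormalismInductionProofs
import Literature.NumberTheory.EllipticCurves.IsogenyQuadraticTwistProofs
import Literature.NumberTheory.QuadraticFields.SquareRootGenerator
import HarnessLib

/-!
# Galois bookkeeping for a quadratic base change: the quadratic character, `res(Γ_K)`, and the
# inertia / Frobenius dictionary at inert and ramified primes

`Proofs` file (theorems only) in topic `NumberTheory/EllipticCurves`, landed bottom-up for the
named fact `WeierstrassCurve.LSeries_baseChange_quadratic` (Ireland–Rosen, Prop. 20.5.4(b):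
`L(E_K/K, s) = L(E/ℚ, s) L(E^{(d_K)}/ℚ, s)` for a quadratic field `K`).  The global proof compares,
prime by prime, the Euler factors of `V_ℓ(E)|_{Γ_K}` (restriction along
`res = absGaloisRestrict ℚ K : Γ_K → Γ_ℚ`), of `V_ℓ(E)` and of `V_ℓ(E) ⊗ χ_K`; this file supplies
the arithmetic glue, for a square-root generator `θ ∈ K`, `θ² = c ∈ F`, `θ ∉ F` of a quadratic
extension `K/F` (`√c = WeierstrassCurve.geomSqrt c ∈ F̄`):

* `exists_quadraticCharacter` — the character `χ : Γ_F → kˣ` with `χ(σ) = ±1` according to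
  `σ√c = ±√c` (a homomorphism because `σ√c = ±√c` for every `σ`);
* `absGaloisRestrict_smul_geomSqrt`, `exists_smul_geomSqrt_eq_neg`,
  `mem_range_absGaloisRestrict_of_smul_geomSqrt` — `res(Γ_K)` fixes `√c`, some `σ ∈ Γ_F`
  negates it (lift the conjugation of `K/F` to `K̄ ≅ F̄`), hence `res(Γ_K)` is exactly the
  stabiliser of `√c` (both have index `2`), i.e. the kernel of `χ`;
* `absGaloisRestrict_mul_pow_inv_mem_inertia` — for finite `M/F`, a Frobenius `Φ ∈ Γ_M` at
  `𝔔 ∣ w` restricts to `Frob_𝔓^{f(w|v)}` modulo `I_𝔓`, `𝔓 = ι⁻¹𝔔` (Neukirch I (9.4)–(9.5));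
* `exists_mem_inertia_not_mem_range` — if `w` is the only place of `M` above `v` and
  `f(w|v) = 1` (a totally ramified prime), then `I_𝔓 ⊄ res(Γ_M)` (otherwise `D_𝔓 ≤ res(Γ_M)`,
  `D_𝔓 = ⟨Frob⟩ I_𝔓 U` for the open subgroup `U = res(Γ_M)`, and a second `res(Γ_M)`-orbit of
  primes above `v` would give a second place).

## References

* J. Neukirch, *Algebraic Number Theory* (1999), Ch. I §9, (9.1)–(9.6). [NeukirchANT1999]
* K. Ireland, M. Rosen, *A Classical Introduction to Modern Number Theory*, 2nd ed. (1990),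
  Prop. 20.5.4. [IrelandRosen1990]
-/

noncomputable section

open scoped Classical NumberField Pointwise
open Field IsDedekindDomain NumberField WeierstrassCurve

universe u

namespace Literature.NumberTheory.EllipticCurves

open Literature.NumberTheory.GaloisRepresentations Literature.NumberTheory.QuadraticFields

/-! ## The quadratic character attached to `√c` -/

section Character

variable {F : Type u} [Field F] [NeZero (2 : F)]

/-- `√c ≠ -√c` for `c ≠ 0` when `2 ≠ 0`. [folklore] -/
theorem geomSqrt_ne_neg {c : F} (hc : c ≠ 0) : geomSqrt c ≠ -geomSqrt c := by
  intro h
  have h2 : (2 : AlgebraicClosure F) * geomSqrt c = 0 := by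
    rw [two_mul]
    nth_rewrite 2 [h]
    rw [add_neg_cancel]
  have h2' : (2 : AlgebraicClosure F) ≠ 0 := by
    rw [← map_ofNat (algebraMap F (AlgebraicClosure F)) 2]
    exact (map_ne_zero _).mpr two_ne_zero
  rcases mul_eq_zero.mp h2 with h0 | h0
  · exact h2' h0
  · exact geomSqrt_ne_zero hc h0

omit [NeZero (2 : F)] in
/-- Every `σ ∈ Γ_F` sends `√c` to `√c` or to `-√c` (`map_geomSqrt`, stated for the action of
`absoluteGaloisGroup F`). [folklore] -/
theorem smul_geomSqrt_eq_or (σ : absoluteGaloisGroup F) (c : F) :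
    σ • geomSqrt c = geomSqrt c ∨ σ • geomSqrt c = -geomSqrt c :=
  map_geomSqrt (absoluteGaloisGroup.toAlgEquiv F σ) c

/-- **The quadratic character of `F(√c)/F`**: for `c ≠ 0` (and `2 ≠ 0`) and any commutative ring
`k` there is a homomorphism `χ : Γ_F → kˣ` with `χ(σ) = 1` if `σ√c = √c` and `χ(σ) = -1` if
`σ√c = -√c` (in particular `χ(σ) = ±1` for all `σ`).  [folklore] -/
theorem exists_quadraticCharacter {c : F} (hc : c ≠ 0) (k : Type*) [CommRing k] :
    ∃ χ : absoluteGaloisGroup F →* kˣ,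
      (∀ σ, σ • geomSqrt c = geomSqrt c → χ σ = 1) ∧
      (∀ σ, σ • geomSqrt c = -geomSqrt c → χ σ = -1) ∧
      (∀ σ, χ σ = 1 ∨ χ σ = -1) := by
  have hne := geomSqrt_ne_neg hc
  have hne' : -geomSqrt c ≠ geomSqrt c := fun h ↦ hne h.symm
  let f : absoluteGaloisGroup F → kˣ := fun σ ↦ if σ • geomSqrt c = geomSqrt c then 1 else -1
  have hf1 : ∀ σ, σ • geomSqrt c = geomSqrt c → f σ = 1 := fun σ h ↦ if_pos h
  have hf2 : ∀ σ, σ • geomSqrt c = -geomSqrt c → f σ = -1 := fun σ h ↦ by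
    have h' : ¬ σ • geomSqrt c = geomSqrt c := by rw [h]; exact hne'
    exact if_neg h'
  refine ⟨{ toFun := f, map_one' := hf1 1 (one_smul _ _), map_mul' := fun σ τ ↦ ?_ },
    hf1, hf2, fun σ ↦ ?_⟩
  · change f (σ * τ) = f σ * f τ
    rcases smul_geomSqrt_eq_or τ c with hτ | hτ <;> rcases smul_geomSqrt_eq_or σ c with hσ | hσ
    · rw [hf1 τ hτ, hf1 σ hσ, mul_one, hf1 _ (by rw [mul_smul, hτ, hσ])]
    · rw [hf1 τ hτ, hf2 σ hσ, mul_one, hf2 _ (by rw [mul_smul, hτ, hσ])]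
    · rw [hf2 τ hτ, hf1 σ hσ, one_mul, hf2 _ (by rw [mul_smul, hτ, smul_neg, hσ])]
    · rw [hf2 τ hτ, hf2 σ hσ, neg_mul_neg, one_mul,
        hf1 _ (by rw [mul_smul, hτ, smul_neg, hσ, neg_neg])]
  · change f σ = 1 ∨ f σ = -1
    rcases smul_geomSqrt_eq_or σ c with hσ | hσ
    · exact Or.inl (hf1 σ hσ)
    · exact Or.inr (hf2 σ hσ)

end Character

/-! ## `res(Γ_K)` and `√c` for `K = F(θ)`, `θ² = c` -/

section Restrict

variable {F K : Type u} [Field F] [Field K] [Algebra F K]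

/-- If `θ ∈ K` with `θ² = c ∈ F`, the chosen embedding `ι : F̄ → K̄` sends `√c ∈ F̄` to `±θ ∈ K̄`.
[folklore] -/
theorem absClosureEmbedding_geomSqrt_eq_or {c : F} {θ : K} (hθ : θ ^ 2 = algebraMap F K c) :
    absClosureEmbedding F K (geomSqrt c) = algebraMap K (AlgebraicClosure K) θ ∨
      absClosureEmbedding F K (geomSqrt c) = -algebraMap K (AlgebraicClosure K) θ := by
  apply sq_eq_sq_iff_eq_or_eq_neg.mp
  rw [← map_pow, geomSqrt_sq, AlgHom.commutes, ← map_pow, hθ,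
    ← IsScalarTower.algebraMap_apply]

/-- **`res(Γ_K)` fixes `√c`** when `c` is a square in `K`: for `θ ∈ K` with `θ² = c` and
`γ ∈ Γ_K`, `res(γ) • √c = √c` (`ι(res γ • √c) = γ • ι√c = γ • (±θ) = ±θ`). [folklore] -/
theorem absGaloisRestrict_smul_geomSqrt {c : F} {θ : K} (hθ : θ ^ 2 = algebraMap F K c)
    (γ : absoluteGaloisGroup K) : absGaloisRestrict F K γ • geomSqrt c = geomSqrt c := by
  apply (absClosureEmbedding F K).toRingHom.injective
  change absClosureEmbedding F K (absGaloisRestrict F K γ • geomSqrt c) =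
    absClosureEmbedding F K (geomSqrt c)
  rw [absGaloisRestrict_apply_smul]
  have hfix : γ • algebraMap K (AlgebraicClosure K) θ = algebraMap K (AlgebraicClosure K) θ := by
    rw [absoluteGaloisGroup.smul_def]
    exact AlgEquiv.commutes _ θ
  rcases absClosureEmbedding_geomSqrt_eq_or hθ with h | h
  · rw [h, hfix]
  · rw [h, smul_neg, hfix]

/-- **Some `σ ∈ Γ_F` negates `√c`** when `K = F(θ)` is quadratic with `θ² = c`, `θ ∉ F`: lift the
conjugation `θ ↦ -θ` of `K/F` (`Literature.NumberTheory.QuadraticFields.Quadratic.conj`) to `K̄`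
(Mathlib `AlgHom.liftNormal`) and transport it to `F̄` along `ι : F̄ ≅ K̄`. [folklore] -/
theorem exists_smul_geomSqrt_eq_neg [Algebra.IsAlgebraic F K] (h2 : Module.finrank F K = 2)
    {c : F} {θ : K} (hθF : θ ∉ Set.range (algebraMap F K)) (hθ : θ ^ 2 = algebraMap F K c) :
    ∃ σ : absoluteGaloisGroup F, σ • geomSqrt c = -geomSqrt c := by
  -- the conjugation of `K/F`, lifted to `K̄`
  set g : K →ₐ[F] K := Quadratic.conj h2 hθF hθ with hg
  have hgθ : g θ = -θ := Quadratic.conj_gen h2 hθF hθ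
  haveI : Algebra.IsAlgebraic F (AlgebraicClosure K) := Algebra.IsAlgebraic.trans F K _
  haveI : IsAlgClosure F (AlgebraicClosure K) := ⟨inferInstance, inferInstance⟩
  set gt : AlgebraicClosure K →ₐ[F] AlgebraicClosure K := g.liftNormal (AlgebraicClosure K)
    with hgt
  have hgtθ : gt (algebraMap K (AlgebraicClosure K) θ) = -algebraMap K (AlgebraicClosure K) θ := by
    rw [hgt, AlgHom.liftNormal_commutes, hgθ, map_neg]
  set gte : AlgebraicClosure K ≃ₐ[F] AlgebraicClosure K :=
    AlgEquiv.ofBijective gt (Algebra.IsAlgebraic.algHom_bijective gt) with hgte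
  -- `ι : F̄ ≅ K̄`
  letI := absClosureAlgebra F K
  haveI := absClosure_isScalarTower F K
  haveI : Algebra.IsAlgebraic (AlgebraicClosure F) (AlgebraicClosure K) :=
    Algebra.IsAlgebraic.tower_top (K := F) (AlgebraicClosure F)
  have hbij : Function.Bijective (absClosureEmbedding F K) :=
    IsAlgClosed.algebraMap_bijective_of_isIntegral (k := AlgebraicClosure F)
      (K := AlgebraicClosure K)
  set ιe : AlgebraicClosure F ≃ₐ[F] AlgebraicClosure K :=
    AlgEquiv.ofBijective (absClosureEmbedding F K) hbij with hιe
  have hιe' : ∀ y, ιe y = absClosureEmbedding F K y := fun _ ↦ rfl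
  -- `σ = ι⁻¹ g̃ ι`
  refine ⟨(absoluteGaloisGroup.toAlgEquiv F).symm (ιe.trans (gte.trans ιe.symm)), ?_⟩
  rw [absoluteGaloisGroup.smul_def, MulEquiv.apply_symm_apply, AlgEquiv.trans_apply,
    AlgEquiv.trans_apply]
  apply ιe.injective
  rw [AlgEquiv.apply_symm_apply, map_neg, hιe']
  change gt (absClosureEmbedding F K (geomSqrt c)) = _
  rcases absClosureEmbedding_geomSqrt_eq_or hθ with h | h
  · rw [h, hgtθ]
  · rw [h, map_neg, hgtθ]

variable [NumberField F] [NumberField K]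

/-- **`res(Γ_K)` is the stabiliser of `√c`** for the quadratic field `K = F(θ)`, `θ² = c`,
`θ ∉ F`: an element of `Γ_F` fixing `√c` lies in the image of `Γ_K → Γ_F` (that image fixes
`√c`, has index `[K : F] = 2`, and the stabiliser is a proper subgroup by
`exists_smul_geomSqrt_eq_neg`, so the two subgroups of index `2` coincide). [folklore] -/
theorem mem_range_absGaloisRestrict_of_smul_geomSqrt (h2 : Module.finrank F K = 2)
    {c : F} {θ : K} (hθF : θ ∉ Set.range (algebraMap F K)) (hθ : θ ^ 2 = algebraMap F K c)
    {σ : absoluteGaloisGroup F} (hσ : σ • geomSqrt c = geomSqrt c) :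
    σ ∈ (absGaloisRestrict F K).range := by
  haveI : FiniteDimensional F K := Module.finite_of_finrank_pos (by rw [h2]; exact two_pos)
  haveI : Algebra.IsAlgebraic F K := Algebra.IsAlgebraic.of_finite F K
  set H := (absGaloisRestrict F K).range with hH
  set S : Subgroup (absoluteGaloisGroup F) :=
    MulAction.stabilizer (absoluteGaloisGroup F) (geomSqrt c) with hS
  have hHS : H ≤ S := by
    rintro _ ⟨γ, rfl⟩
    exact absGaloisRestrict_smul_geomSqrt hθ γ
  have hHi : H.index = 2 := by rw [hH, index_range_absGaloisRestrict_eq_finrank, h2]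
  haveI : H.FiniteIndex := ⟨by rw [hHi]; exact two_ne_zero⟩
  have hSne : S ≠ ⊤ := by
    obtain ⟨τ, hτ⟩ := exists_smul_geomSqrt_eq_neg h2 hθF hθ
    intro htop
    have hτS : τ ∈ S := htop ▸ Subgroup.mem_top τ
    have hc0 : c ≠ 0 := fun h0 ↦ hθF (by
      rw [h0, map_zero, sq_eq_zero_iff] at hθ
      exact ⟨0, by rw [map_zero, hθ]⟩)
    rw [hS, MulAction.mem_stabilizer_iff] at hτS
    rw [hτS] at hτ
    haveI : NeZero (2 : F) := ⟨two_ne_zero⟩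
    exact geomSqrt_ne_neg hc0 hτ
  have hSi : S.index ≠ 1 := fun h ↦ hSne (Subgroup.index_eq_one.mp h)
  have hHeqS : H = S := by
    by_contra hne
    have hlt : H < S := lt_of_le_of_ne hHS hne
    have h1 := Subgroup.index_strictAnti hlt
    have h2' := Subgroup.index_dvd_of_le hHS
    rw [hHi] at h1 h2'
    have : S.index = 1 ∨ S.index = 2 := by
      rcases (Nat.dvd_prime Nat.prime_two).mp h2' with h | h
      · exact Or.inl h
      · exact Or.inr h
    omega
  rw [hHeqS, hS]
  exact hσ

end Restrict

/-! ## Frobenius and inertia under `Γ_M → Γ_F` at inert and totally ramified primes -/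

section Frobenius

variable {F M : Type u} [Field F] [NumberField F] [Field M] [NumberField M] [Algebra F M]

/-- **A Frobenius of `M` restricts to `Frob^{f(w|v)}` modulo inertia** (Neukirch I (9.4)–(9.5)):
for `𝔔 ∣ w ∣ v`, `𝔓 = ι⁻¹ 𝔔`, an arithmetic Frobenius `Φ ∈ Γ_M` at `𝔔` and an arithmetic
Frobenius `φ ∈ Γ_F` at `𝔓`, `res(Φ) · (φ^{f(w|v)})⁻¹ ∈ I_𝔓` — both act on `\bar ℤ_F / 𝔓` as
`x ↦ x^{q_v^f} = x^{q_w}`. [cite: NeukirchANT1999, Ch. I §9 (9.4)–(9.5)] -/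
theorem absGaloisRestrict_mul_pow_inv_mem_inertia [Algebra.IsAlgebraic F M]
    {v : HeightOneSpectrum (𝓞 F)} {w : HeightOneSpectrum (𝓞 M)}
    (hw : w.asIdeal.under (𝓞 F) = v.asIdeal) {𝔔 : Ideal (absIntegers (𝓞 M) M)}
    (h𝔔 : 𝔔 ∈ w.primesAbove) {Φ : absoluteGaloisGroup M} (hΦ : IsArithFrobAt (𝓞 M) Φ 𝔔)
    {φ : absoluteGaloisGroup F} (hφ : IsArithFrobAt (𝓞 F) φ (𝔔.comap (absIntegersMap F M))) :
    absGaloisRestrict F M Φ * (φ ^ w.asIdeal.inertiaDeg (𝓞 F))⁻¹ ∈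
      (𝔔.comap (absIntegersMap F M)).inertia (absoluteGaloisGroup F) := by
  have h𝔓 := comap_absIntegersMap_mem_primesAbove hw h𝔔
  have hΦ' := (HeightOneSpectrum.isArithFrobAt_iff_of_mem_primesAbove h𝔔 Φ).mp hΦ
  have hres : ∀ x : absIntegers (𝓞 F) F,
      absGaloisRestrict F M Φ • x - x ^ (v.residueCard ^ w.asIdeal.inertiaDeg (𝓞 F)) ∈
        𝔔.comap (absIntegersMap F M) := by
    rw [← residueCard_eq_residueCard_pow_inertiaDeg hw]
    exact (forall_smul_sub_pow_mem_comap_iff F M 𝔔 Φ w.residueCard).mpr hΦ'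
  exact mul_inv_mem_inertia_of_forall_smul_sub_pow_mem hres
    (smul_pow_sub_pow_mem_of_isArithFrobAt h𝔓 hφ _)

-- the pointwise `Γ_F`-action on ideals of `\bar ℤ_F` needs a longer instance search
-- (as in `ArtinFormalismInductionProofs`)
set_option synthInstance.maxHeartbeats 80000 in
/-- **At a totally ramified prime, inertia does not lie in `res(Γ_M)`.**  Let `M/F` be a finite
extension of number fields with `res(Γ_M) ≠ Γ_F`, `w` the *only* place of `M` above the place
`v` of `F`, of residue degree `f(w|v) = 1`, and `𝔔 ∣ w`, `𝔓 = ι⁻¹ 𝔔`.  Then some `τ ∈ I_𝔓` is not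
in `res(Γ_M)`.  Otherwise `res(Φ)` (for a Frobenius `Φ` of `M` at `𝔔`) is a Frobenius at `𝔓`
(`f = 1`) lying in the open subgroup `U = res(Γ_M)`, so `D_𝔓 = ⟨res Φ⟩ I_𝔓 U ≤ U`
(`exists_eq_frobenius_pow_mul_of_mem_decompositionSubgroup`); for `c ∉ U` the prime `c𝔓` lies
below a place of `M` above `v`, which must be `w`, so `c𝔓 = res(γ)𝔓` for some `γ ∈ Γ_M`
(transitivity of `Γ_M` on the primes above `w`), whence `res(γ)⁻¹ c ∈ D_𝔓 ≤ U` and `c ∈ U`.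
(For `M = K` quadratic this is the ramified case `e = 2`, `f = 1`.)
[cite: NeukirchANT1999, Ch. I §9 (9.1)–(9.6)] -/
theorem exists_mem_inertia_not_mem_range [FiniteDimensional F M]
    {v : HeightOneSpectrum (𝓞 F)} {w : HeightOneSpectrum (𝓞 M)}
    (hw : w.asIdeal.under (𝓞 F) = v.asIdeal)
    (huniq : ∀ w' : HeightOneSpectrum (𝓞 M), w'.asIdeal.under (𝓞 F) = v.asIdeal → w' = w)
    {𝔔 : Ideal (absIntegers (𝓞 M) M)} (h𝔔 : 𝔔 ∈ w.primesAbove)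
    (hf : w.asIdeal.inertiaDeg (𝓞 F) = 1) (hH : (absGaloisRestrict F M).range ≠ ⊤) :
    ∃ τ ∈ (𝔔.comap (absIntegersMap F M)).inertia (absoluteGaloisGroup F),
      τ ∉ (absGaloisRestrict F M).range := by
  haveI : Algebra.IsAlgebraic F M := Algebra.IsAlgebraic.of_finite F M
  set U := (absGaloisRestrict F M).range with hU
  set 𝔓 := 𝔔.comap (absIntegersMap F M) with h𝔓def
  have h𝔓 : 𝔓 ∈ v.primesAbove := comap_absIntegersMap_mem_primesAbove hw h𝔔
  by_contra hcon
  push Not at hcon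
  -- a Frobenius in `U`
  obtain ⟨Φ, hΦ⟩ := HeightOneSpectrum.exists_isArithFrobAt_of_mem_primesAbove_holds h𝔔
  have hφ : IsArithFrobAt (𝓞 F) (absGaloisRestrict F M Φ) 𝔓 :=
    isArithFrobAt_absGaloisRestrict_of_inertiaDeg_eq_one hw h𝔔 hΦ hf
  have hφU : absGaloisRestrict F M Φ ∈ U := ⟨Φ, rfl⟩
  -- `U` is open
  haveI : U.FiniteIndex := finiteIndex_range_absGaloisRestrict F M
  have hUopen : IsOpen (U : Set (absoluteGaloisGroup F)) := by
    refine Subgroup.isOpen_of_isClosed_of_finiteIndex U ?_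
    rw [hU, MonoidHom.coe_range]
    exact isClosed_range_absGaloisRestrict (K := F) (L := M)
  -- `D_𝔓 ≤ U`
  have hD : 𝔓.decompositionSubgroup (absoluteGaloisGroup F) ≤ U := by
    intro d hd
    obtain ⟨n, i, u, hi, hu, rfl⟩ :=
      exists_eq_frobenius_pow_mul_of_mem_decompositionSubgroup h𝔓 hφ hUopen hd
    exact U.mul_mem (U.mul_mem (U.pow_mem hφU n) (hcon i hi)) hu
  -- a second `U`-orbit of primes above `v` would be a second place
  obtain ⟨c, hc⟩ : ∃ c : absoluteGaloisGroup F, c ∉ U := by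
    by_contra h
    push Not at h
    exact hH (eq_top_iff.mpr fun x _ ↦ h x)
  obtain ⟨𝔔', w', h𝔔'c, hw'v, h𝔔'w'⟩ := exists_place_comap_eq_smul (M := M) h𝔓 c
  have hw' : w' = w := huniq w' hw'v
  rw [hw'] at h𝔔'w'
  obtain ⟨γ, hγ⟩ := HeightOneSpectrum.exists_smul_eq_of_mem_primesAbove_holds h𝔔 h𝔔'w'
  have hcomap : absGaloisRestrict F M γ • 𝔓 = c • 𝔓 := by
    rw [h𝔓def, ← comap_absIntegersMap_smul, hγ, h𝔔'c]
  have hmem : (absGaloisRestrict F M γ)⁻¹ * c ∈ 𝔓.decompositionSubgroup (absoluteGaloisGroup F) := by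
    rw [Ideal.mem_decompositionSubgroup_iff, mul_smul, ← hcomap, inv_smul_smul]
  apply hc
  have : c = absGaloisRestrict F M γ * ((absGaloisRestrict F M γ)⁻¹ * c) := by group
  rw [this]
  exact U.mul_mem ⟨γ, rfl⟩ (hD hmem)

end Frobenius

end Literature.NumberTheory.EllipticCurves
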